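import Summits.Ventures.YMGap.RobustBall.PerturbedExistence
import Summits.Ventures.YMGap.RobustBall.RobustMassGapDoor
import Mathlib.Analysis.Normed.Group.FunctionSeries
import HarnessLib

/-!
# Venture YMGap, track ROBUST-BALL (tier 2) — the perturbed specification for SUMMABLE (infinite-range) link potentials

HONEST FRAMING. WHAT THIS IS: a venture file (cell `pub-ymgap`, track Y2 ROBUST-BALL, seat rb-p1): the
TIER-2 `ℤ^d` object. The tier-1 carrier (`perturbedYM ρ β W supp`, `PerturbedSpecification.lean`) asks a
locally finite support family; here the link potential `W = (W_X)_{X ⋐ links}` may have INFINITELY many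
active terms through every link, controlled only by a SUMMABLE majorant `|W_X| ≤ B_X`,
`∑_{X ∋ e} B_X < ∞` for every link `e` (the diameter-weighted Banach norm of the directive dominates
this). Contents: the finite-volume energy `-β S_Λ - ∑'_{X ∩ Λ ≠ ∅} W_X` as a `tsum` (summable, bounded,
continuous by the Weierstrass M-test — Mathlib `continuous_tsum`), the specification `perturbedYMS ρ β W`
and `IsSpecification` (tree `isSpecification_tilted_map_glueWith_pi`; relative-energy locality termwise),
the Feller property and EXISTENCE of DLR states (the generic `exists_isGibbsMeasure_of_feller` of
`PerturbedExistence.lean`), and the one-link law in 't Hooft form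
`σ_N.tilted (g ↦ N Re tr(g B_ω) - V_ω(g))`, `V_ω(g) = ∑'_{X ∋ e} W_X(ω^{e←g})`. The DOOR (Dobrushin's
condition with summable, exponentially weighted rows, on lit-1's `DobrushinMetricInfiniteRange`) is the
next file. WHAT THIS IS NOT: no uniqueness / clustering here; lattice object only; no continuum claim.

## References

* H.-O. Georgii (2011), Def. 2.9 with (2.3) (absolutely summable potentials), (2.11); S. Friedli,
  Y. Velenik (2017), §6.10.1 (6.110)–(6.111), Lemma 6.15.
-/

noncomputable section

open MeasureTheory Filter Function Topology
open Literature.Probability.LatticeModels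
open Literature.Probability.LatticeModels.DobrushinMetric
open Literature.MathematicalPhysics.QuantumLattice
open Literature.MathematicalPhysics.QuantumFieldTheory hiding ZdEdge

namespace Summit.Ventures.YMGap.RobustBall

variable {d N : ℕ} {G : Type*}

/-! ### Summable majorants through links and through volumes -/

section Majorant

/-- **A summable link majorant** of the potential `W`: `|W_X(U)| ≤ B_X` for all `U`, and for every link
`e` the family `(B_X)_{X ∋ e}` is summable (Georgii 2011, (2.3): absolute summability of the potential
through every site). -/
structure IsLinkSummable (W : Potential (ZdEdge d) G) (B : Finset (ZdEdge d) → ℝ) : Prop where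
  /-- the termwise bound -/
  abs_le : ∀ X U, |W X U| ≤ B X
  /-- summability through every link -/
  summable : ∀ e : ZdEdge d, Summable fun X => if e ∈ X then B X else 0

variable {W : Potential (ZdEdge d) G} {B : Finset (ZdEdge d) → ℝ}

/-- The majorant is nonnegative on nonempty sets. -/
theorem IsLinkSummable.nonneg (h : IsLinkSummable W B) (X : Finset (ZdEdge d)) (U : LGConfig d G) :
    0 ≤ B X := (abs_nonneg _).trans (h.abs_le X U)

/-- The volume majorant: `g_Λ(X) = ∑_{e ∈ Λ} 𝟙[e ∈ X] B_X`, summable in `X` (finite sum of summable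
families) and dominating `𝟙[X ∩ Λ ≠ ∅] B_X`. -/
theorem IsLinkSummable.summable_volume (h : IsLinkSummable W B) (Λ : Finset (ZdEdge d)) :
    Summable fun X => ∑ e ∈ Λ, (if e ∈ X then B X else 0) :=
  summable_sum fun e _ => h.summable e

/-- Domination: the term of `X` in the volume `Λ` is bounded by the volume majorant. -/
theorem IsLinkSummable.abs_term_le (h : IsLinkSummable W B) [Nonempty (LGConfig d G)] (Λ : Finset (ZdEdge d))
    (X : Finset (ZdEdge d)) (U : LGConfig d G) :
    |(if (X ∩ Λ).Nonempty then W X U else 0)| ≤ ∑ e ∈ Λ, (if e ∈ X then B X else 0) := by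
  have hB0 : 0 ≤ B X := h.nonneg X U
  split_ifs with hX
  · obtain ⟨e, he⟩ := hX
    rw [Finset.mem_inter] at he
    have hnn : ∀ e' ∈ Λ, 0 ≤ (fun e' => if e' ∈ X then B X else 0) e' := fun e' _ => by
      simp only
      split_ifs
      · exact hB0
      · exact le_rfl
    calc |W X U| ≤ B X := h.abs_le X U
      _ = (fun e' => if e' ∈ X then B X else 0) e := by simp only [if_pos he.1]
      _ ≤ ∑ e' ∈ Λ, (fun e' => if e' ∈ X then B X else 0) e' := Finset.single_le_sum hnn he.2
      _ = ∑ e ∈ Λ, (if e ∈ X then B X else 0) := rfl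
  · rw [abs_zero]
    exact Finset.sum_nonneg fun e _ => by
      split_ifs
      · exact hB0
      · exact le_rfl

/-- The volume family of terms is summable, for every configuration. -/
theorem IsLinkSummable.summable_term (h : IsLinkSummable W B) [Nonempty (LGConfig d G)]
    (Λ : Finset (ZdEdge d)) (U : LGConfig d G) :
    Summable fun X => (if (X ∩ Λ).Nonempty then W X U else 0) :=
  Summable.of_norm_bounded (h.summable_volume Λ) fun X => by
    rw [Real.norm_eq_abs]; exact h.abs_term_le Λ X U

end Majorant

/-! ### The summable perturbed energy -/

section Energy

variable [Group G] (ρ : G →* Matrix (Fin N) (Fin N) ℂ)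

/-- **The tier-2 perturbed finite-volume log-weight**:
`perturbedEnergyS ρ β W Λ U = -β S_Λ(U) - ∑'_{X ∩ Λ ≠ ∅} W_X(U)` — the interaction of ALL finite link sets
meeting `Λ` (an absolutely convergent series under `IsLinkSummable`; Georgii 2011, (2.11) for summable
potentials). -/
def perturbedEnergyS (β : ℝ) (W : Potential (ZdEdge d) G) (Λ : Finset (ZdEdge d)) (U : LGConfig d G) : ℝ :=
  -β * wilsonBoundaryAction ρ Λ U - ∑' X : Finset (ZdEdge d), (if (X ∩ Λ).Nonempty then W X U else 0)

variable {W : Potential (ZdEdge d) G} {B : Finset (ZdEdge d) → ℝ}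

/-- The energy is bounded: `|φ_Λ| ≤ sup|β S_Λ| + ∑' g_Λ`. -/
theorem exists_abs_perturbedEnergyS_le [TopologicalSpace G] [IsTopologicalGroup G] [CompactSpace G]
    (hρ : Continuous ρ) (β : ℝ) (h : IsLinkSummable W B) (Λ : Finset (ZdEdge d)) :
    ∃ C, ∀ U, |perturbedEnergyS ρ β W Λ U| ≤ C := by
  haveI : Nonempty (LGConfig d G) := ⟨fun _ => 1⟩
  obtain ⟨C₀, hC₀⟩ := exists_bound_of_continuous
    (continuous_const.mul (continuous_wilsonBoundaryAction ρ hρ Λ) : Continuous fun U : LGConfig d G =>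
      -β * wilsonBoundaryAction ρ Λ U)
  refine ⟨C₀ + ∑' X, ∑ e ∈ Λ, (if e ∈ X then B X else 0), fun U => ?_⟩
  calc |perturbedEnergyS ρ β W Λ U|
      ≤ |-β * wilsonBoundaryAction ρ Λ U| + |∑' X, (if (X ∩ Λ).Nonempty then W X U else 0)| := abs_sub _ _
    _ ≤ C₀ + ∑' X, ∑ e ∈ Λ, (if e ∈ X then B X else 0) := by
        refine add_le_add (hC₀ U) ?_
        have h1 := norm_tsum_le_tsum_norm ((h.summable_term Λ U).norm)
        simp only [Real.norm_eq_abs] at h1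
        exact h1.trans ((h.summable_term Λ U).abs.tsum_le_tsum (fun X => h.abs_term_le Λ X U)
          (h.summable_volume Λ))

/-- The energy is continuous when `ρ` and every term are continuous (Weierstrass M-test,
Mathlib `continuous_tsum`). -/
theorem continuous_perturbedEnergyS [TopologicalSpace G] [IsTopologicalGroup G] (hρ : Continuous ρ) (β : ℝ)
    (h : IsLinkSummable W B) (hWc : ∀ X, Continuous (W X)) (Λ : Finset (ZdEdge d)) :
    Continuous (perturbedEnergyS ρ β W Λ) := by
  haveI : Nonempty (LGConfig d G) := ⟨fun _ => 1⟩
  unfold perturbedEnergyS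
  refine (continuous_const.mul (continuous_wilsonBoundaryAction ρ hρ Λ)).sub ?_
  refine continuous_tsum (fun X => ?_) (h.summable_volume Λ) fun X U => ?_
  · by_cases hX : (X ∩ Λ).Nonempty
    · simp only [if_pos hX]; exact hWc X
    · simp only [if_neg hX]; exact continuous_const
  · rw [Real.norm_eq_abs]; exact h.abs_term_le Λ X U

/-- **Relative-energy locality** (termwise): for `Λ ⊆ Λ'`, `φ_{Λ'} - φ_Λ` does not depend on the links
in `Λ` — the Wilson part by `dependsOn_wilsonBoundaryAction_sub`, the series part because the terms
meeting `Λ'` but not `Λ` depend only on links off `Λ`. -/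
theorem dependsOn_perturbedEnergyS_sub (β : ℝ) (h : IsLinkSummable W B)
    (hWdep : ∀ X, DependsOn (W X) (↑X : Set (ZdEdge d))) {Λ Λ' : Finset (ZdEdge d)} (hsub : Λ ⊆ Λ') :
    DependsOn (fun U : LGConfig d G => perturbedEnergyS ρ β W Λ' U - perturbedEnergyS ρ β W Λ U)
      ((↑Λ : Set (ZdEdge d))ᶜ) := by
  haveI : Nonempty (LGConfig d G) := ⟨fun _ => 1⟩
  intro U U' hUU'
  have h1 := dependsOn_wilsonBoundaryAction_sub (G := G) ρ hsub hUU'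
  simp only at h1 ⊢
  -- the series parts: difference of the two volume series, termwise
  have hdiff : ∀ V : LGConfig d G,
      (∑' X, (if (X ∩ Λ').Nonempty then W X V else 0)) - ∑' X, (if (X ∩ Λ).Nonempty then W X V else 0) =
        ∑' X, (if (X ∩ Λ').Nonempty ∧ ¬ (X ∩ Λ).Nonempty then W X V else 0) := fun V => by
    rw [← (h.summable_term Λ' V).tsum_sub (h.summable_term Λ V)]
    refine tsum_congr fun X => ?_
    by_cases hX : (X ∩ Λ).Nonempty
    · have hX' : (X ∩ Λ').Nonempty := hX.mono (Finset.inter_subset_inter subset_rfl hsub)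
      simp [hX, hX']
    · by_cases hX' : (X ∩ Λ').Nonempty
      · simp [hX, hX']
      · simp [hX, hX']
  have hterm : ∀ X, (if (X ∩ Λ').Nonempty ∧ ¬ (X ∩ Λ).Nonempty then W X U else 0) =
      (if (X ∩ Λ').Nonempty ∧ ¬ (X ∩ Λ).Nonempty then W X U' else 0) := fun X => by
    split_ifs with hX
    · exact hWdep X fun e he => hUU' e (fun heΛ => hX.2 ⟨e, Finset.mem_inter.2 ⟨he, heΛ⟩⟩)
    · rfl
  have hseries : (∑' X, (if (X ∩ Λ').Nonempty then W X U else 0)) -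
      ∑' X, (if (X ∩ Λ).Nonempty then W X U else 0) =
      (∑' X, (if (X ∩ Λ').Nonempty then W X U' else 0)) - ∑' X, (if (X ∩ Λ).Nonempty then W X U' else 0) := by
    rw [hdiff U, hdiff U', tsum_congr hterm]
  simp only [perturbedEnergyS]
  linear_combination (-β) * h1 - hseries

end Energy

/-! ### The tier-2 specification, `IsSpecification`, Feller, existence -/

section Spec

variable [Group G] (ρ : G →* Matrix (Fin N) (Fin N) ℂ) [TopologicalSpace G] [IsTopologicalGroup G]
  [CompactSpace G] [MeasurableSpace G] [BorelSpace G]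

/-- **The tier-2 perturbed lattice Yang–Mills specification on `ℤ^d`** for a link-summable potential:
product Haar on the links of `Λ`, glued with the boundary condition, tilted by `perturbedEnergyS`. -/
def perturbedYMS (β : ℝ) (W : Potential (ZdEdge d) G) : Specification (ZdEdge d) G :=
  fun Λ η => ((Measure.pi fun _ : ↥Λ => haarProbability G).map (glueWith Λ · η)).tilted
    (perturbedEnergyS ρ β W Λ)

/-- The DLR states of the tier-2 member. -/
def perturbedGibbsMeasuresS (β : ℝ) (W : Potential (ZdEdge d) G) : Set (Measure (LGConfig d G)) :=
  gibbsMeasures (perturbedYMS ρ β W)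

variable [SecondCountableTopology G] {W : Potential (ZdEdge d) G} {B : Finset (ZdEdge d) → ℝ}

/-- **The tier-2 kernels form a specification** for continuous `ρ`, continuous terms depending on
their own links, and a summable link majorant (Georgii 2011, Def. 2.9 for absolutely summable
potentials; Friedli–Velenik 2017, Lemma 6.15 / §6.10.1). -/
theorem isSpecification_perturbedYMS [T2Space G] (hρ : Continuous ρ) (β : ℝ) (h : IsLinkSummable W B)
    (hWc : ∀ X, Continuous (W X)) (hWdep : ∀ X, DependsOn (W X) (↑X : Set (ZdEdge d))) :
    IsSpecification (perturbedYMS (d := d) ρ β W) :=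
  isSpecification_tilted_map_glueWith_pi (V := ZdEdge d) (haarProbability G)
    (φ := fun Λ => perturbedEnergyS ρ β W Λ)
    (fun Λ => (continuous_perturbedEnergyS ρ hρ β h hWc Λ).measurable)
    (fun Λ => exists_abs_perturbedEnergyS_le ρ hρ β h Λ)
    (fun _ _ hsub => dependsOn_perturbedEnergyS_sub ρ β h hWdep hsub)

/-- **Feller property of the tier-2 kernels** (continuous bounded energy; same argument as
`continuous_integral_perturbedYM`). -/
theorem continuous_integral_perturbedYMS (hρ : Continuous ρ) (β : ℝ) (h : IsLinkSummable W B)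
    (hWc : ∀ X, Continuous (W X)) (Λ : Finset (ZdEdge d)) {F : LGConfig d G → ℝ} (hF : Continuous F)
    {C : ℝ} (hC : ∀ U, |F U| ≤ C) :
    Continuous fun η => ∫ U, F U ∂(perturbedYMS ρ β W Λ η) := by
  have hφ : Continuous (perturbedEnergyS ρ β W Λ) := continuous_perturbedEnergyS ρ hρ β h hWc Λ
  have hw : Continuous fun U : LGConfig d G => Real.exp (perturbedEnergyS ρ β W Λ U) :=
    Real.continuous_exp.comp hφ
  obtain ⟨Bw, hBw⟩ := exists_bound_of_continuous hw
  -- un-normalised integrals are continuous in the boundary condition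
  have hnum : ∀ {F' : LGConfig d G → ℝ}, Continuous F' → ∀ {C' : ℝ}, (∀ U, |F' U| ≤ C') →
      Continuous fun η : LGConfig d G => ∫ ζ, F' (glueWith Λ ζ η) *
        Real.exp (perturbedEnergyS ρ β W Λ (glueWith Λ ζ η)) ∂(Measure.pi fun _ : ↥Λ => haarProbability G) := by
    intro F' hF' C' hC'
    have hΦ : Continuous fun p : LGConfig d G × (↥Λ → G) =>
        F' (glueWith Λ p.2 p.1) * Real.exp (perturbedEnergyS ρ β W Λ (glueWith Λ p.2 p.1)) :=
      (hF'.comp (continuous_glueWith_prod Λ)).mul (hw.comp (continuous_glueWith_prod Λ))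
    refine continuous_integral_of_bound (fun η => hΦ.comp (Continuous.prodMk_right η))
      (fun ζ => hΦ.comp (Continuous.prodMk_left ζ)) (C := C' * Bw) fun η ζ => ?_
    rw [abs_mul]
    exact mul_le_mul (hC' _) (hBw _) (abs_nonneg _) ((abs_nonneg _).trans (hC' (glueWith Λ ζ η)))
  have hformula : ∀ η, ∫ U, F U ∂(perturbedYMS ρ β W Λ η) =
      (∫ ζ, F (glueWith Λ ζ η) * Real.exp (perturbedEnergyS ρ β W Λ (glueWith Λ ζ η))
          ∂(Measure.pi fun _ : ↥Λ => haarProbability G)) /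
        ∫ ζ, Real.exp (perturbedEnergyS ρ β W Λ (glueWith Λ ζ η))
          ∂(Measure.pi fun _ : ↥Λ => haarProbability G) := by
    intro η
    have hg : Measurable (glueWith Λ · η) := measurable_glueWith Λ η
    unfold perturbedYMS
    rw [integral_tilted, integral_map hg.aemeasurable hw.aestronglyMeasurable, integral_map hg.aemeasurable]
    · simp only [smul_eq_mul]
      rw [← integral_div]
      refine congrArg _ (funext fun ζ => ?_)
      ring
    · exact ((hw.measurable.div_const _).mul hF.measurable).aestronglyMeasurable
  simp only [hformula]
  have hZ := hnum (F' := fun _ => (1 : ℝ)) continuous_const (C' := 1) (fun _ => by simp)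
  simp only [one_mul] at hZ
  refine (hnum hF hC).div hZ fun η => ?_
  have hw' : Continuous fun ζ : ↥Λ → G => Real.exp (perturbedEnergyS ρ β W Λ (glueWith Λ ζ η)) :=
    hw.comp ((continuous_glueWith_prod Λ).comp (Continuous.prodMk_right η))
  obtain ⟨B', hB'⟩ := exists_bound_of_continuous hw'
  exact (integral_exp_pos (integrable_of_bound hw'.aestronglyMeasurable hB')).ne'

/-- **Existence of DLR states of the tier-2 member** (Feller + compactness, the generic
`exists_isGibbsMeasure_of_feller`). -/
theorem perturbedGibbsMeasuresS_nonempty [T2Space G] (hρ : Continuous ρ) (β : ℝ) (h : IsLinkSummable W B)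
    (hWc : ∀ X, Continuous (W X)) (hWdep : ∀ X, DependsOn (W X) (↑X : Set (ZdEdge d))) :
    (perturbedGibbsMeasuresS (d := d) ρ β W).Nonempty :=
  haveI : Nonempty G := ⟨1⟩
  exists_isGibbsMeasure_of_feller (isSpecification_perturbedYMS ρ hρ β h hWc hWdep)
    fun Λ _ hF _ hC => continuous_integral_perturbedYMS ρ hρ β h hWc Λ hF hC

/-- The one-link law of the tier-2 member is Haar tilted by the one-link energy
(`siteLaw_tilted_map_glueWith_pi`). -/
theorem siteLaw_perturbedYMS_eq_tilted_haar (hρ : Continuous ρ) (β : ℝ) (h : IsLinkSummable W B)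
    (hWc : ∀ X, Continuous (W X)) (e : ZdEdge d) (ω : LGConfig d G) :
    siteLaw (perturbedYMS ρ β W) e ω =
      (haarProbability G).tilted fun g => perturbedEnergyS ρ β W {e} (Function.update ω e g) :=
  siteLaw_tilted_map_glueWith_pi (haarProbability G) (fun Λ => perturbedEnergyS ρ β W Λ) e
    (continuous_perturbedEnergyS ρ hρ β h hWc {e}).measurable ω

end Spec

/-! ### `SU(N)`, 't Hooft scaling: the one-link law as a perturbed tilted Haar measure -/

section SUN

/-- The ONE-LINK PERTURBATION of the tier-2 member at `e` with boundary condition `ω`: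
`V_ω(g) = ∑'_{X ∋ e} W_X(ω^{e←g})` (sets through `e` are exactly the sets meeting `{e}`). -/
theorem tsum_inter_singleton_eq {G : Type*} (W : Potential (ZdEdge d) G) (e : ZdEdge d) (U : LGConfig d G) :
    (∑' X : Finset (ZdEdge d), (if (X ∩ {e}).Nonempty then W X U else 0)) =
      ∑' X : Finset (ZdEdge d), (if e ∈ X then W X U else 0) :=
  tsum_congr fun X => by simp only [inter_singleton_nonempty_iff]

/-- **The one-link law of the tier-2 `SU(N)` member at bare coupling `N β`** is
`σ_N.tilted (g ↦ N Re tr(g B_ω) - ∑'_{X ∋ e} W_X(ω^{e←g}))` (tree staple field `B_ω`;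
`thooft_wilsonBoundaryAction_update`, `tilted_const_add_eq`). -/
theorem siteLaw_perturbedYMS_thooft (β : ℝ) {W : Potential (ZdEdge d) (Matrix.specialUnitaryGroup (Fin N) ℂ)}
    {B : Finset (ZdEdge d) → ℝ} (h : IsLinkSummable W B) (hWc : ∀ X, Continuous (W X))
    (e : ZdEdge d) (ω : LGConfig d (Matrix.specialUnitaryGroup (Fin N) ℂ)) :
    siteLaw (perturbedYMS (fundamentalRep (Fin N)) (N * β) W) e ω =
      (haarProbability (Matrix.specialUnitaryGroup (Fin N) ℂ)).tilted
        fun g => (N : ℝ) * ((g : Matrix (Fin N) (Fin N) ℂ) * stapleField β e ω).trace.re -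
          ∑' X : Finset (ZdEdge d), (if e ∈ X then W X (Function.update ω e g) else 0) := by
  classical
  haveI : SecondCountableTopology (Matrix (Fin N) (Fin N) ℂ) :=
    inferInstanceAs (SecondCountableTopology (Fin N → Fin N → ℂ))
  haveI : SecondCountableTopology (Matrix.specialUnitaryGroup (Fin N) ℂ) :=
    Topology.IsEmbedding.subtypeVal.secondCountableTopology
  rw [siteLaw_perturbedYMS_eq_tilted_haar _ (continuous_fundamentalRep (Fin N)) _ h hWc]
  have : (fun g : Matrix.specialUnitaryGroup (Fin N) ℂ =>
      perturbedEnergyS (fundamentalRep (Fin N)) (N * β) W {e} (Function.update ω e g)) =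
      fun g : Matrix.specialUnitaryGroup (Fin N) ℂ =>
        -((N : ℝ) * β) * ((N : ℝ) * (plaquettesTouching {e}).card) +
          ((N : ℝ) * ((g : Matrix (Fin N) (Fin N) ℂ) * stapleField β e ω).trace.re -
            ∑' X : Finset (ZdEdge d), (if e ∈ X then W X (Function.update ω e g) else 0)) := by
    funext g
    rw [perturbedEnergyS, thooft_wilsonBoundaryAction_update β e ω g, tsum_inter_singleton_eq]
    ring
  rw [this, tilted_const_add_eq]

end SUN

end Summit.Ventures.YMGap.RobustBall
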